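/-
Copyright (c) 2026 the pub-hodgecm-mathlib formalisation cell (harness21).  Prover seat hodgecm-mathlib-K2E5-p16 (g3) (cross-unit hand on E3's BONUS road (d-w) of ‹J3› v2,
road owner K2E3-p03 (g3), brick (W3-aux) offered 2026-09-04T02:48:10Z): at a WILD ramified place the anisotropic unitary plane `U(⟨1,−ξ⟩)` is NEVER integral.
-/
import Literature.NumberTheory.LocalFields.WildQuadraticDatumNormSignConductor     -- ★ `exists_fixed_unit_not_norm_v_sub_one_le`, `exists_mul_map_eq_of_fixed_of_v_sub_one_le_pred`, `exists_nonnorm_dichotomy` (+ ★ datum toolkit `v_varpi_pow`, `eq_succ_of_odd`, `mul_map_mul_map`)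
import Summits.HodgeConjecture.HodgeConjecture.Theorems.F0P3cDyRamWildPlaceDatum      -- ★ `exists_isRamifiedQuadraticDatum_of_placesOver` (the datum at a ramified CM place)
import Literature.NumberTheory.Automorphic.RamifiedPlaceBlockWild                    -- ★ `exists_valued_eq_exp_neg_one` (a uniformiser of `L_w`)
import Literature.NumberTheory.Automorphic.AdicCompletionCompact                     -- ★ `finite_residueField_adicCompletion`
import Literature.NumberTheory.Weil1982.UnitaryFinTopFormAnisotropicPlaneUnitIntegral  -- ED. 2: ★ (r) `anisoPlaneUnit_integralLevel_top_and_compactSpace` (contrast) + ★ `placeForm_anisoPlane`, `localNonsplitEquiv`, `mem_localIntegralLevel_iff_of_smul_eq`, `mem_glInt_iff_forall_v_le_one_and_v_det_eq_one`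
import Literature.NumberTheory.Automorphic.UnitaryQuaternionDictionaryRankTwo         -- ED. 2: ★ `mem_unitaryGroupOfForm_and_det_eq_one_iff` (Rogawski §3.8 dictionary `q(a,b)`)
import HarnessLib

/-!
# K2 ∕ E3, road (d-w) of ‹J3› v2 — brick (W3-aux) `K2E3WildAnisotropicPlaneNonIntegral`: AT A WILD RAMIFIED PLACE THE ANISOTROPIC UNITARY PLANE `U(⟨1,−ξ⟩)` IS NEVER INTEGRAL

Cell `hodgecm-mathlib` (Track B «K2-LIT»), item h413 = `stmt-HodgeConjecture-24833`, route of record `route-HodgeConjecture-HCCMUnconditional`; PROOF lane (theorems only: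
no `def`, no `instance`, no `notation`, no named fact, no `sorry`), `--supports stmt-HodgeConjecture-24833 --as helper`; count-neutral.  ROAD (d-w) (dyadic ramified leaf (J3d-w)
of ‹J3› v2, owner K2E3-p03 (g3), CENSUS-J3dw §2 (K) ∕ §3 W3): the residual letter (W3) compares the residual counts `[U(⟨1,−ξ₀⟩)_v : K_an(2ϖ_v)]` and `[K₂ : K₂(2ϖ_v)]`.
At a TAME ramified place the anisotropic plane `U(⟨1,−ξ⟩)(L⁺_v)` (`ξ` a unit of `L_w` which is not a norm) IS its own integral model (★ `anisoPlaneUnit_integralLevel_top_and_compactSpace`: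
`U ≤ GL₂(𝒪_w)`, because `1 + 𝔭 ⊆ N(L_w^×)`); THIS FILE proves that at a WILD ramified place (`2 ∈ v`) this ALWAYS FAILS — so the W3 typists must count `[U_an : K_an] > 1` as well
(road owner's remark (1), 2026-09-04T02:48:10Z; his worked instance: `L_w = ℚ₂(i)`, `ξ = 3`, `α = (1+2i)∕(1+i)`, `β = 1∕(1+i)`, `Nα − 3Nβ = 1`).

THE MATHEMATICS (★ datum currency `IsRamifiedQuadraticDatum σ ϖ d t` on ONE field `K = E` with involution `σ`, fixed field `F`, `N z := z·σz`; [Serre1979, V §3 Cor. 3, XV §2]).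
Let `ξ` be a `σ`-fixed unit which is NOT a norm.  We want `α, β` with `Nα − ξ·Nβ = 1` and `|β| > 1`.  ANSATZ: `Nβ := (ξy)⁻¹`, `Nα := (1+y)∕y` for a fixed `y ≠ 0` with `|y| < 1`;
then `Nα − ξNβ = (1+y)∕y − 1∕y = 1` and `|β|² = |y|⁻¹ > 1`.  So we need a small fixed `y` with BOTH `ξy ∈ N` (i.e. `y ∉ N`, index two) AND `(1+y)∕y ∈ N` (i.e. `1 + y ∉ N`):
a NON-norm `1 + y` close to `1` whose «logarithm» `y` is also a non-norm.  At a TAME place `1 + 𝔭_F ⊆ N` and no such `y` exists (consistently with ★ integrality).  At a WILD place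
(`|2| < 1`, so `d ≥ 2`): take the ★ sharp non-norm fixed unit `c ≡ 1 (mod ϖ^{2d−2})` (★ `exists_fixed_unit_not_norm_v_sub_one_le`), `y₀ := c − 1 ≠ 0`.  If `y₀ ∉ N`, put `y := y₀`
(`1 + y = c ∉ N`).  If `y₀ ∈ N`, put `y := y₀·c ∉ N`; then `1 + y = c + y₀² = c·(1 + y₀²∕c)` and `|y₀²| ≤ |ϖ|^{4(d−1)} ≤ |ϖ|^{2d−1}` (as `d ≥ 2`), so `1 + y₀²∕c ∈ N` by the ★ deep-norm
theorem (`exists_mul_map_eq_of_fixed_of_v_sub_one_le_pred`, Serre's `ψ`) and `1 + y ∈ c·N` is a non-norm.  The index-two bookkeeping (non-norm × non-norm = norm) is ★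
`exists_nonnorm_dichotomy` (`x² = N x` for fixed `x`).

* §1 norm-class algebra under a dichotomy witness (`IsNorm x := ∃ z, z·σz = x` spelt out; products, inverses, squares of fixed elements, non-norm × non-norm).
* §2 `two_le_d_of_valued_two_lt_one` (wild ⇒ `d ≥ 2`), **`exists_fixed_small_nonnorm_log`** (the `y`), **`exists_norm_sub_mul_norm_eq_one_one_lt`** (`∃ α β, Nα − ξNβ = 1 ∧ |β| > 1`).
* §3 MATRIX FORM: `g := !![α, ξ·σβ; β, σα]` satisfies `(g.map σ)ᵀ · diag(1,−ξ) · g = diag(1,−ξ)`, `det g = 1`, and has the NON-INTEGRAL entry `β` — `SU(⟨1,−ξ⟩)(F) ⊄ SL₂(𝒪_E)`.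
* §4 CM DRESS at a wild ramified place `w ∣ v` of `L ∕ L⁺` (`c • w = w`, `e(w|v) ≠ 1`, `2 ∈ v`; `σ_w = galAdicCompletionMap c hw`; ★ `exists_isRamifiedQuadraticDatum_of_placesOver`): for
  every `ξ ∈ L` with `c ξ = ξ`, `|ξ|_w = 1`, `ξ_w ∉ N(L_w^×)` (the W1 package ★ `K2E3CompactSheetBlockModelWild.exists_global_unit_not_norm`, p856881) there are `α, β ∈ L_w` with
  `α·σ_wα − ξ_w·β·σ_wβ = 1` and `|β|_w > 1`, and the matrix form.
* §5 (ED. 2) THE CM-CARRIER READING: **`cmLocalIntegralLevel_anisoPlane_ne_top_of_wild`** — `cmLocalIntegralLevel L 2 !![1,0;0,−ξ] v ≠ ⊤` at a wild ramified place for the W1 unit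
  `ξ` (the literal negation of the (r) lemma ★ `anisoPlaneUnit_integralLevel_top_and_compactSpace`'s first clause; via the ★ Rogawski §3.8 dictionary
  `mem_unitaryGroupOfForm_and_det_eq_one_iff`, the one-place model ★ `localNonsplitEquiv` and ★ `mem_localIntegralLevel_iff_of_smul_eq`).

HONEST LABEL: HC_CM is proved only modulo the 7 printed citations (2 remaining named inputs: hLiu418 = stmt-HodgeConjecture-24832, h413 = stmt-HodgeConjecture-24833) until rung 0
closes; (J3d-w) and (W3) are NOT proved here; this is a count-neutral structural remark for the (L)∕W3 typists of road (d-w).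

## References
* [Serre1979] J.-P. Serre, *Local Fields*, GTM 67 (1979) — Ch. V §3 Prop. 5, Cor. 2–3 (norm groups of a ramified quadratic extension; conductor ≥ 2 iff wild), Ch. XV §2.
* [Jacobowitz1962] R. Jacobowitz, *Hermitian forms over local fields*, Amer. J. Math. 84 (1962) — §§9–11 (ramified dyadic hermitian planes; non-modular unimodular behaviour).
* [Rogawski1990] J. D. Rogawski, *Automorphic Representations of Unitary Groups in Three Variables*, Ann. of Math. Stud. 123 (1990) — §3.8 p. 33 (the anisotropic `U(2)`).
* [Kottwitz1988] R. Kottwitz, *Tamagawa numbers*, Ann. of Math. 127 (1988) — §1 Thm. 1 (why only the RATIO of the two residual counts is place-free).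
-/

set_option autoImplicit false
set_option linter.dupNamespace false

noncomputable section

namespace Summit.HodgeConjecture.HodgeConjecture.Cruxes.H413.K2E3WildAnisotropicPlaneNonIntegral

open WithZero NumberField IsDedekindDomain
open scoped Valued Matrix
open Literature.NumberTheory.Automorphic Literature.NumberTheory.Automorphic.UnitaryGroup
open Literature.NumberTheory.Automorphic.UnitaryThreeFourFrame (IsRamifiedQuadraticDatum)
open Literature.NumberTheory.LocalFields.WildQuadraticDatum
open Summit.HodgeConjecture.HodgeConjecture.Cruxes.H413.F0P3cDyRamWildPlaceDatum (exists_isRamifiedQuadraticDatum_of_placesOver)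

/-! ## §1 Norm-class algebra on one field with involution (`N z = z·σz`) -/

section NormAlgebra

variable {K : Type} [Field K] {σ : K →+* K}

/-- Norms multiply: `N z₁ · N z₂ = N(z₁z₂)`. [cite: Serre1979, Ch. V §3 Prop. 5] -/
theorem isNorm_mul {x₁ x₂ : K} (h₁ : ∃ z : K, z * σ z = x₁) (h₂ : ∃ z : K, z * σ z = x₂) : ∃ z : K, z * σ z = x₁ * x₂ := by
  obtain ⟨z₁, rfl⟩ := h₁
  obtain ⟨z₂, rfl⟩ := h₂
  exact ⟨z₁ * z₂, (mul_map_mul_map z₁ z₂).symm⟩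

/-- Inverses of norms are norms: `(N z)⁻¹ = N(z⁻¹)`. [cite: Serre1979, Ch. V §3 Prop. 5] -/
theorem isNorm_inv {x : K} (h : ∃ z : K, z * σ z = x) : ∃ z : K, z * σ z = x⁻¹ := by
  obtain ⟨z, rfl⟩ := h
  exact ⟨z⁻¹, by rw [map_inv₀, mul_inv]⟩

/-- The square of a `σ`-fixed element is a norm: `x·x = x·σx`. [cite: Serre1979, Ch. V §3 Prop. 5] -/
theorem isNorm_mul_self_of_fixed {x : K} (hσx : σ x = x) : ∃ z : K, z * σ z = x * x :=
  ⟨x, by rw [hσx]⟩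

/-- A norm times a non-norm is a non-norm. [cite: Serre1979, Ch. V §3 Cor. 3] -/
theorem not_isNorm_mul_of_isNorm_of_not_isNorm {x₁ x₂ : K} (hx₁0 : x₁ ≠ 0) (h₁ : ∃ z : K, z * σ z = x₁) (h₂ : ¬ ∃ z : K, z * σ z = x₂) :
    ¬ ∃ z : K, z * σ z = x₁ * x₂ := by
  intro h
  refine h₂ ?_
  obtain ⟨z, hz⟩ := isNorm_mul (isNorm_inv h₁) h
  exact ⟨z, by rw [hz, inv_mul_cancel_left₀ hx₁0]⟩

/-- **Non-norm × non-norm = norm under an index-two dichotomy witness** `c₀` (`c₀` fixed, not a norm, every non-zero fixed `x` is a norm or `c₀·x` is):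
`x₁x₂ = (c₀x₁)(c₀x₂)∕c₀²` with `c₀² = N c₀`. [cite: Serre1979, Ch. V §3 Cor. 3] [cite: NeukirchANT1999, Ch. V (1.3)] -/
theorem isNorm_mul_of_not_isNorm_of_not_isNorm {c₀ : K} (hσc₀ : σ c₀ = c₀) (hc₀N : ¬ ∃ z : K, z * σ z = c₀)
    (hdich : ∀ x : K, σ x = x → x ≠ 0 → (∃ z : K, z * σ z = x) ∨ ∃ z : K, z * σ z = c₀ * x)
    {x₁ x₂ : K} (hσx₁ : σ x₁ = x₁) (hx₁0 : x₁ ≠ 0) (hσx₂ : σ x₂ = x₂) (hx₂0 : x₂ ≠ 0)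
    (h₁ : ¬ ∃ z : K, z * σ z = x₁) (h₂ : ¬ ∃ z : K, z * σ z = x₂) : ∃ z : K, z * σ z = x₁ * x₂ := by
  have hc₀0 : c₀ ≠ 0 := by
    rintro rfl
    exact hc₀N ⟨0, by rw [zero_mul]⟩
  have hcx₁ : ∃ z : K, z * σ z = c₀ * x₁ := (hdich x₁ hσx₁ hx₁0).resolve_left h₁
  have hcx₂ : ∃ z : K, z * σ z = c₀ * x₂ := (hdich x₂ hσx₂ hx₂0).resolve_left h₂
  obtain ⟨z, hz⟩ := isNorm_mul (isNorm_mul hcx₁ hcx₂) (isNorm_inv (isNorm_mul_self_of_fixed hσc₀))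
  refine ⟨z, ?_⟩
  rw [hz]
  field_simp

end NormAlgebra

/-! ## §2 The small non-norm logarithm and the non-integral solution of `Nα − ξ·Nβ = 1` -/

section Datum

variable {K : Type} [Field K] [Valued K ℤᵐ⁰] {σ : K →+* K} {ϖ : K} {d t : ℕ}

/-- At a WILD ramified datum (`|2| < 1`) the different exponent is at least `2` (`d = 1` is odd, forcing `d = t + 1`, `t = 0`, `|2| = 1`; ★ `eq_succ_of_odd`).
[cite: Serre1979, Ch. III §6 Prop. 13; Ch. V §3] -/
theorem two_le_d_of_valued_two_lt_one (hD : IsRamifiedQuadraticDatum σ ϖ d t) (h2v : Valued.v (2 : K) < 1) : 2 ≤ d := by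
  obtain ⟨hσ, -, hϖ, hfix, hd, hd1, ht⟩ := hD
  by_contra hlt
  have hodd : Odd d := ⟨0, by omega⟩
  have hdt := eq_succ_of_odd hσ hfix hϖ hd ht hodd
  have ht0 : t = 0 := by omega
  rw [ht, ht0, pow_zero] at h2v
  exact lt_irrefl _ h2v

/-- **THE SMALL NON-NORM LOGARITHM.**  At a wild ramified datum over a complete field with finite residue field, for every fixed non-norm unit `ξ` there is a fixed `y ≠ 0` with
`|y| ≤ exp(−2(d−1))` (so `|y| < 1`), `ξ·y ∈ N` and `(1 + y)∕y ∈ N` — from the ★ sharp non-norm `c ≡ 1 (mod ϖ^{2d−2})`: `y = c − 1` or `y = (c − 1)·c` according as `c − 1 ∉ N` or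
`∈ N` (then `1 + y = c·(1 + (c−1)²∕c)` with `(c−1)² ∈ 𝔭^{4(d−1)} ⊆ 𝔭^{2d−1}`, a deep norm).  No such `y` exists at a tame place (`1 + 𝔭_F ⊆ N`).
[cite: Serre1979, Ch. V §3 Prop. 5, Cor. 2–3; Ch. XV §2] -/
theorem exists_fixed_small_nonnorm_log [CompleteSpace K] [Finite 𝓀[K]] (hD : IsRamifiedQuadraticDatum σ ϖ d t) (h2v : Valued.v (2 : K) < 1)
    {ξ : K} (hσξ : σ ξ = ξ) (hξ1 : Valued.v ξ = 1) (hξN : ¬ ∃ z : K, z * σ z = ξ) :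
    ∃ y : K, σ y = y ∧ y ≠ 0 ∧ Valued.v y ≤ exp (-(2 * ((d - 1 : ℕ) : ℤ))) ∧
      (∃ z : K, z * σ z = ξ * y) ∧ ∃ z : K, z * σ z = (1 + y) * y⁻¹ := by
  have hD' := hD
  obtain ⟨hσ, hvσ, hϖ, hfix, hd, hd1, ht⟩ := hD'
  have hd2 : 2 ≤ d := two_le_d_of_valued_two_lt_one hD h2v
  have hξ0 : ξ ≠ 0 := fun h => by rw [h, map_zero] at hξ1; exact zero_ne_one hξ1
  -- the sharp non-norm fixed unit `c` and the dichotomy witness `c₀`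
  obtain ⟨c, hσc, hc1, hcle, hcN⟩ := exists_fixed_unit_not_norm_v_sub_one_le hD h2v
  obtain ⟨c₀, hσc₀, hc₀N, hdich⟩ := exists_nonnorm_dichotomy hD
  have hc0 : c ≠ 0 := fun h => by rw [h, map_zero] at hc1; exact zero_ne_one hc1
  have hy₀0 : c - 1 ≠ 0 := by
    intro h
    rw [sub_eq_zero] at h
    exact hcN ⟨1, by rw [map_one, one_mul, h]⟩
  have hσy₀ : σ (c - 1) = c - 1 := by rw [map_sub, hσc, map_one]
  by_cases hy₀N : ∃ z : K, z * σ z = c - 1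
  · -- CASE `c − 1 ∈ N`: `y := (c − 1)·c`
    refine ⟨(c - 1) * c, by rw [map_mul, hσy₀, hσc], mul_ne_zero hy₀0 hc0, ?_, ?_, ?_⟩
    · rw [map_mul, hc1, mul_one]; exact hcle
    · -- `ξ·((c−1)·c) = (c−1)·(ξ·c)`, `ξ·c` = non-norm × non-norm
      have hξc : ∃ z : K, z * σ z = ξ * c := isNorm_mul_of_not_isNorm_of_not_isNorm hσc₀ hc₀N hdich hσξ hξ0 hσc hc0 hξN hcN
      obtain ⟨z, hz⟩ := isNorm_mul hy₀N hξc
      exact ⟨z, by rw [hz]; ring⟩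
    · -- `1 + (c−1)c = c·u`, `u := 1 + (c−1)²∕c` a deep fixed one-unit, hence a norm; `(1+y)∕y = u∕(c−1)`
      have hσu : σ (1 + (c - 1) * (c - 1) / c) = 1 + (c - 1) * (c - 1) / c := by
        rw [map_add, map_one, map_div₀, map_mul, hσy₀, hσc]
      have hule : Valued.v (1 + (c - 1) * (c - 1) / c - 1) ≤ Valued.v ϖ ^ (4 * (d - 1)) := by
        rw [add_sub_cancel_left, map_div₀, map_mul, hc1, div_one, v_varpi_pow hϖ,
          show (-(((4 * (d - 1) : ℕ) : ℤ)) : ℤ) = -(2 * ((d - 1 : ℕ) : ℤ)) + -(2 * ((d - 1 : ℕ) : ℤ)) by push_cast; ring, exp_add]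
        exact mul_le_mul' hcle hcle
      have huN : ∃ z : K, z * σ z = 1 + (c - 1) * (c - 1) / c :=
        exists_mul_map_eq_of_fixed_of_v_sub_one_le_pred hD hσu (n := 4 * (d - 1)) (by omega) hule
      obtain ⟨z, hz⟩ := isNorm_mul huN (isNorm_inv hy₀N)
      refine ⟨z, ?_⟩
      rw [hz]
      field_simp
      ring
  · -- CASE `c − 1 ∉ N`: `y := c − 1`
    refine ⟨c - 1, hσy₀, hy₀0, ?_, ?_, ?_⟩
    · exact hcle
    · exact isNorm_mul_of_not_isNorm_of_not_isNorm hσc₀ hc₀N hdich hσξ hξ0 hσy₀ hy₀0 hξN hy₀N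
    · -- `(1 + (c−1))∕(c−1) = c·(c−1)⁻¹` = non-norm × non-norm
      have hinvN : ¬ ∃ z : K, z * σ z = (c - 1)⁻¹ := fun h => hy₀N (by simpa only [inv_inv] using isNorm_inv h)
      have h := isNorm_mul_of_not_isNorm_of_not_isNorm hσc₀ hc₀N hdich hσc hc0 (by rw [map_inv₀, hσy₀]) (inv_ne_zero hy₀0) hcN hinvN
      obtain ⟨z, hz⟩ := h
      exact ⟨z, by rw [hz, add_sub_cancel]⟩

/-- **`Nα − ξ·Nβ = 1` HAS A SOLUTION WITH `|β| > 1` AT EVERY WILD RAMIFIED DATUM, FOR EVERY FIXED NON-NORM UNIT `ξ`** (so the unitary group of the anisotropic binary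
hermitian form `x·σx − ξ·y·σy` over the fixed field is NOT contained in the integral points): `Nβ = (ξy)⁻¹`, `Nα = (1+y)∕y` with the small non-norm logarithm `y` of
`exists_fixed_small_nonnorm_log`. [cite: Serre1979, Ch. V §3 Cor. 3; Ch. XV §2] [cite: Jacobowitz1962, §§9–11] -/
theorem exists_norm_sub_mul_norm_eq_one_one_lt [CompleteSpace K] [Finite 𝓀[K]] (hD : IsRamifiedQuadraticDatum σ ϖ d t) (h2v : Valued.v (2 : K) < 1)
    {ξ : K} (hσξ : σ ξ = ξ) (hξ1 : Valued.v ξ = 1) (hξN : ¬ ∃ z : K, z * σ z = ξ) :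
    ∃ α β : K, α * σ α - ξ * (β * σ β) = 1 ∧ 1 < Valued.v β := by
  have hvσ := hD.2.1
  have hd2 : 2 ≤ d := two_le_d_of_valued_two_lt_one hD h2v
  have hξ0 : ξ ≠ 0 := fun h => by rw [h, map_zero] at hξ1; exact zero_ne_one hξ1
  obtain ⟨y, -, hy0, hyle, ⟨z₂, hz₂⟩, ⟨z₁, hz₁⟩⟩ := exists_fixed_small_nonnorm_log hD h2v hσξ hξ1 hξN
  have hz₂0 : z₂ ≠ 0 := by
    rintro rfl
    rw [zero_mul] at hz₂
    exact mul_ne_zero hξ0 hy0 hz₂.symm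
  refine ⟨z₁, z₂⁻¹, ?_, ?_⟩
  · rw [map_inv₀, ← mul_inv, hz₂, hz₁]
    field_simp
    ring
  · -- `|z₂|² = |ξ y| = |y| < 1`, so `|z₂| < 1` and `|z₂⁻¹| > 1`
    have hy1 : Valued.v y < 1 := by
      refine lt_of_le_of_lt hyle ?_
      rw [← exp_zero, exp_lt_exp]; omega
    have hz₂v : Valued.v z₂ * Valued.v z₂ < 1 := by
      have hmul : Valued.v z₂ * Valued.v z₂ = Valued.v (z₂ * σ z₂) := by rw [map_mul, hvσ]
      rw [hmul, hz₂, map_mul, hξ1, one_mul]; exact hy1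
    have hz₂lt : Valued.v z₂ < 1 := by
      by_contra hle
      rw [not_lt] at hle
      exact absurd (one_le_mul hle hle) (not_le.2 hz₂v)
    rw [map_inv₀]
    exact (one_lt_inv₀ ((Valuation.pos_iff _).2 hz₂0)).2 hz₂lt

/-! ## §3 Matrix form: a non-integral element of `SU(⟨1, −ξ⟩)` -/

/-- **A NON-INTEGRAL SPECIAL UNITARY MATRIX FOR THE ANISOTROPIC PLANE `⟨1, −ξ⟩` AT A WILD RAMIFIED DATUM**: with `Nα − ξNβ = 1`, `|β| > 1` (§2), the matrix `g = !![α, ξ·σβ; β, σα]`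
satisfies `(σg)ᵀ · diag(1, −ξ) · g = diag(1, −ξ)`, `det g = 1`, and `|g₁₀| > 1`.  (At a tame place every such `g` is integral, ★ `anisoPlaneUnit_integralLevel_top_and_compactSpace`.)
[cite: Rogawski1990, §3.8 p. 33] [cite: Jacobowitz1962, §§9–11] [cite: Serre1979, Ch. V §3 Cor. 3] -/
theorem exists_unitary_anisoPlane_not_integral [CompleteSpace K] [Finite 𝓀[K]] (hD : IsRamifiedQuadraticDatum σ ϖ d t) (h2v : Valued.v (2 : K) < 1)
    {ξ : K} (hσξ : σ ξ = ξ) (hξ1 : Valued.v ξ = 1) (hξN : ¬ ∃ z : K, z * σ z = ξ) :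
    ∃ g : Matrix (Fin 2) (Fin 2) K, (g.map σ)ᵀ * !![(1 : K), 0; 0, -ξ] * g = !![(1 : K), 0; 0, -ξ] ∧ g.det = 1 ∧ 1 < Valued.v (g 1 0) := by
  have hσ := hD.1
  obtain ⟨α, β, h, hβ⟩ := exists_norm_sub_mul_norm_eq_one_one_lt hD h2v hσξ hξ1 hξN
  refine ⟨!![α, ξ * σ β; β, σ α], ?_, ?_, by simpa using hβ⟩
  · ext i j
    fin_cases i <;> fin_cases j <;>
      simp only [Matrix.mul_apply, Fin.sum_univ_two, Matrix.transpose_apply, Matrix.map_apply, Matrix.of_apply, Matrix.cons_val', Matrix.cons_val_zero,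
        Matrix.cons_val_one, Matrix.empty_val', Matrix.cons_val_fin_one, map_mul, hσ, hσξ, Fin.zero_eta, Fin.mk_one, Fin.isValue] <;>
      first | ring1 | linear_combination h | linear_combination (-ξ) * h
  · rw [Matrix.det_fin_two_of]
    linear_combination h

end Datum

/-! ## §4 CM dress: a wild ramified place `w ∣ v` of `L ∕ L⁺` -/

section CM

variable (L : Type) [Field L] [NumberField L] [IsCMField L] (v : HeightOneSpectrum (𝓞 ↥(maximalRealSubfield L)))
  (w : PlacesOver L v) (hw : IsCMField.complexConj L • w.1 = w.1)

omit [IsCMField L] in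
/-- `|2|_w < 1` at a place of `L` above a dyadic place `v` of `L⁺` (`2 ∈ v`). [cite: Serre1979, Ch. I §1] -/
theorem valued_two_lt_one_of_two_mem (h2 : (2 : 𝓞 ↥(maximalRealSubfield L)) ∈ v.asIdeal) : Valued.v (2 : w.1.adicCompletion L) < 1 := by
  haveI := PlacesOver.liesOver (E := L) w
  have h2w : (2 : 𝓞 L) ∈ w.1.asIdeal := by
    have h := (Ideal.mem_of_liesOver w.1.asIdeal v.asIdeal (2 : 𝓞 ↥(maximalRealSubfield L))).1 h2
    rwa [map_ofNat] at h
  have h := (HeightOneSpectrum.valuation_lt_one_iff_mem (K := L) (v := w.1) (2 : 𝓞 L)).2 h2w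
  have hval : Valued.v (algebraMap L (w.1.adicCompletion L) (2 : L)) = w.1.valuation L (2 : L) := HeightOneSpectrum.valuedAdicCompletion_eq_valuation' w.1 _
  rw [map_ofNat] at hval
  rw [hval]
  simpa only [map_ofNat] using h

/-- `σ_w` fixes the image of a `c`-fixed element of `L` (★ `galAdicCompletionMap_coe_algEquiv`). [cite: CasselsFrohlichANT1967, Ch. VII §1.1] -/
theorem galAdicCompletionMap_algebraMap_of_complexConj_eq {ξ : L} (hξc : IsCMField.complexConj L ξ = ξ) :
    galAdicCompletionMap (L := L) (IsCMField.complexConj L) hw (algebraMap L (w.1.adicCompletion L) ξ) = algebraMap L (w.1.adicCompletion L) ξ := by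
  have hcoe : ((ξ : L) : w.1.adicCompletion L) = algebraMap L (w.1.adicCompletion L) ξ := by
    rw [IsDedekindDomain.HeightOneSpectrum.algebraMap_adicCompletion]; rfl
  rw [← hcoe, galAdicCompletionMap_coe_algEquiv, hξc]

include hw in
/-- **AT A WILD RAMIFIED PLACE THE ANISOTROPIC PLANE `⟨1, −ξ⟩` IS NEVER INTEGRAL (CM dress).**  `L` CM, `w ∣ v` non-split (`c • w = w`) and RAMIFIED (`e(w|v) ≠ 1`) above a DYADIC
`v` (`2 ∈ v`), `σ_w = galAdicCompletionMap c hw`; for every `ξ ∈ L` fixed by `c` whose image `ξ_w` is a unit of `L_w` that is not a norm `t·σ_w t` (the W1 package ★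
`K2E3CompactSheetBlockModelWild.exists_global_unit_not_norm`): there are `α, β ∈ L_w` with `α·σ_wα − ξ_w·(β·σ_wβ) = 1` and `|β|_w > 1`.  Datum by ★
`exists_isRamifiedQuadraticDatum_of_placesOver` at any uniformiser (★ `exists_valued_eq_exp_neg_one`). [cite: Serre1979, Ch. V §3 Cor. 3; Ch. XV §2] [cite: Jacobowitz1962, §§9–11] -/
theorem exists_norm_sub_mul_norm_eq_one_one_lt_place (he : v.asIdeal.ramificationIdx' w.1.asIdeal ≠ 1) (h2 : (2 : 𝓞 ↥(maximalRealSubfield L)) ∈ v.asIdeal)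
    {ξ : L} (hξc : IsCMField.complexConj L ξ = ξ) (hξ1 : Valued.v (algebraMap L (w.1.adicCompletion L) ξ) = 1)
    (hξN : ¬ ∃ t : w.1.adicCompletion L, t * galAdicCompletionMap (L := L) (IsCMField.complexConj L) hw t = algebraMap L (w.1.adicCompletion L) ξ) :
    ∃ α β : w.1.adicCompletion L,
      α * galAdicCompletionMap (L := L) (IsCMField.complexConj L) hw α -
          algebraMap L (w.1.adicCompletion L) ξ * (β * galAdicCompletionMap (L := L) (IsCMField.complexConj L) hw β) = 1 ∧
        1 < Valued.v β := by
  haveI : Finite 𝓀[w.1.adicCompletion L] := finite_residueField_adicCompletion L w.1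
  obtain ⟨ϖ, hϖ⟩ := exists_valued_eq_exp_neg_one L v w
  obtain ⟨d, t, hD⟩ := exists_isRamifiedQuadraticDatum_of_placesOver L w hw he ϖ hϖ
  exact exists_norm_sub_mul_norm_eq_one_one_lt hD (valued_two_lt_one_of_two_mem L v w h2) (galAdicCompletionMap_algebraMap_of_complexConj_eq L v w hw hξc) hξ1 hξN

include hw in
/-- **MATRIX FORM (CM dress)**: at a wild ramified place, for the W1 unit `ξ`, some `g ∈ M₂(L_w)` with `(σ_w g)ᵀ·diag(1,−ξ_w)·g = diag(1,−ξ_w)`, `det g = 1` has `|g₁₀|_w > 1` —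
`SU(⟨1,−ξ⟩)(L⁺_v) ⊄ SL₂(𝒪_w)`, so the (r)-road integrality ★ `anisoPlaneUnit_integralLevel_top_and_compactSpace` has NO wild twin and (W3) must count `[U_an : K_an]`.
[cite: Rogawski1990, §3.8 p. 33] [cite: Jacobowitz1962, §§9–11] [cite: Kottwitz1988, §1 Thm. 1] -/
theorem exists_unitary_anisoPlane_not_integral_place (he : v.asIdeal.ramificationIdx' w.1.asIdeal ≠ 1) (h2 : (2 : 𝓞 ↥(maximalRealSubfield L)) ∈ v.asIdeal)
    {ξ : L} (hξc : IsCMField.complexConj L ξ = ξ) (hξ1 : Valued.v (algebraMap L (w.1.adicCompletion L) ξ) = 1)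
    (hξN : ¬ ∃ t : w.1.adicCompletion L, t * galAdicCompletionMap (L := L) (IsCMField.complexConj L) hw t = algebraMap L (w.1.adicCompletion L) ξ) :
    ∃ g : Matrix (Fin 2) (Fin 2) (w.1.adicCompletion L),
      (g.map (galAdicCompletionMap (L := L) (IsCMField.complexConj L) hw))ᵀ * !![(1 : w.1.adicCompletion L), 0; 0, -algebraMap L (w.1.adicCompletion L) ξ] * g =
          !![(1 : w.1.adicCompletion L), 0; 0, -algebraMap L (w.1.adicCompletion L) ξ] ∧
        g.det = 1 ∧ 1 < Valued.v (g 1 0) := by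
  haveI : Finite 𝓀[w.1.adicCompletion L] := finite_residueField_adicCompletion L w.1
  obtain ⟨ϖ, hϖ⟩ := exists_valued_eq_exp_neg_one L v w
  obtain ⟨d, t, hD⟩ := exists_isRamifiedQuadraticDatum_of_placesOver L w hw he ϖ hϖ
  exact exists_unitary_anisoPlane_not_integral hD (valued_two_lt_one_of_two_mem L v w h2) (galAdicCompletionMap_algebraMap_of_complexConj_eq L v w hw hξc) hξ1 hξN

end CM

/-! ## §5 (ED. 2) The CM-carrier reading: `K_v ≠ U(⟨1,−ξ⟩)(L⁺_v)` at a wild ramified place — the (r) integrality lemma has NO wild twin -/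

section Carrier

open Literature.NumberTheory.Weil1982.UnitaryFinTopForm (placeForm_anisoPlane)
open Literature.NumberTheory.Automorphic.HermitianLatticeTree (mem_glInt_iff_forall_v_le_one_and_v_det_eq_one)

variable (L : Type) [Field L] [NumberField L] [IsCMField L] (v : HeightOneSpectrum (𝓞 ↥(maximalRealSubfield L)))
  (w : PlacesOver L v) (hw : IsCMField.complexConj L • w.1 = w.1)

include hw in
/-- **`K_v ≠ U(⟨1,−ξ⟩)(L⁺_v)` AT A WILD RAMIFIED PLACE** — the literal NEGATION of the (r)-road integrality ★ `anisoPlaneUnit_integralLevel_top_and_compactSpace`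
(there: `cmLocalIntegralLevel L 2 !![1,0;0,−ξ] v = ⊤` at a TAME ramified place for a non-norm unit `ξ`).  Here `w ∣ v` non-split, ramified, DYADIC (`2 ∈ v`), and `ξ ∈ L` the
W1 package (`c ξ = ξ`, `|ξ|_w = 1`, `ξ_w ∉ N(L_w^×)`, ★ p856881): the integral level `U(⟨1,−ξ⟩)(𝒪_v)` is a PROPER subgroup of `U(⟨1,−ξ⟩)(L⁺_v)`.  Proof: §4's `α, β`
give `q(α, σ_wβ) = !![α, ξ_w·σ_wβ; β, σ_wα] ∈ SU(⟨1,−ξ_w⟩)(L_w)` by the ★ Rogawski §3.8 dictionary (`mem_unitaryGroupOfForm_and_det_eq_one_iff`), pulled back to the CM carrier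
along the one-place model ★ `localNonsplitEquiv` (★ `placeForm_anisoPlane`); if `K_v = ⊤` it would lie in `GL₂(𝒪_w)` (★ `mem_localIntegralLevel_iff_of_smul_eq`,
★ `mem_glInt_iff_forall_v_le_one_and_v_det_eq_one`), contradicting `|β|_w > 1`.  So (W3) must count `[U_an : K_an] > 1`.
[cite: Rogawski1990, §3.8 p. 33] [cite: PlatonovRapinchuk1994, §5.1] [cite: Jacobowitz1962, §§9–11] [cite: Kottwitz1988, §1 Thm. 1] -/
theorem cmLocalIntegralLevel_anisoPlane_ne_top_of_wild (he : v.asIdeal.ramificationIdx' w.1.asIdeal ≠ 1) (h2 : (2 : 𝓞 ↥(maximalRealSubfield L)) ∈ v.asIdeal)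
    {ξ : L} (hξc : IsCMField.complexConj L ξ = ξ) (hξ1 : Valued.v (algebraMap L (w.1.adicCompletion L) ξ) = 1)
    (hξN : ¬ ∃ t : w.1.adicCompletion L, t * galAdicCompletionMap (L := L) (IsCMField.complexConj L) hw t = algebraMap L (w.1.adicCompletion L) ξ) :
    cmLocalIntegralLevel L 2 !![(1 : L), 0; 0, -ξ] v ≠ ⊤ := by
  haveI : Algebra.IsQuadraticExtension ↥(maximalRealSubfield L) L := IsCMField.isQuadraticExtension L
  have hc1 : IsCMField.complexConj L ≠ 1 := IsCMField.complexConj_ne_one L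
  have hσ : ∀ x : w.1.adicCompletion L, galAdicCompletionMap (L := L) (IsCMField.complexConj L) hw (galAdicCompletionMap (L := L) (IsCMField.complexConj L) hw x) = x :=
    fun x => galAdicCompletionMap_galAdicCompletionMap_of_smul_eq (IsCMField.complexConj L) w hc1 hw x
  have hσξ := galAdicCompletionMap_algebraMap_of_complexConj_eq L v w hw hξc
  -- §4: the non-integral solution of `Nα − ξ_w Nβ = 1`
  obtain ⟨α, β, h, hβ⟩ := exists_norm_sub_mul_norm_eq_one_one_lt_place L v w hw he h2 hξc hξ1 hξN
  have h' : α * galAdicCompletionMap (L := L) (IsCMField.complexConj L) hw α -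
      algebraMap L (w.1.adicCompletion L) ξ * (galAdicCompletionMap (L := L) (IsCMField.complexConj L) hw β *
        galAdicCompletionMap (L := L) (IsCMField.complexConj L) hw (galAdicCompletionMap (L := L) (IsCMField.complexConj L) hw β)) = 1 := by
    rw [hσ, mul_comm (galAdicCompletionMap (L := L) (IsCMField.complexConj L) hw β) β]; exact h
  -- the Rogawski matrix `q(α, σβ)` as an element of `GL₂(L_w)`
  set M : Matrix (Fin 2) (Fin 2) (w.1.adicCompletion L) := !![α, algebraMap L (w.1.adicCompletion L) ξ * galAdicCompletionMap (L := L) (IsCMField.complexConj L) hw β;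
    galAdicCompletionMap (L := L) (IsCMField.complexConj L) hw (galAdicCompletionMap (L := L) (IsCMField.complexConj L) hw β),
    galAdicCompletionMap (L := L) (IsCMField.complexConj L) hw α] with hM
  have hdet : M.det ≠ 0 := by
    rw [hM, Matrix.det_fin_two_of]
    intro h0
    apply one_ne_zero (α := w.1.adicCompletion L)
    linear_combination h0 - h'
  set G : GL (Fin 2) (w.1.adicCompletion L) := Matrix.GeneralLinearGroup.mkOfDetNeZero M hdet with hG
  have hGM : (G : Matrix (Fin 2) (Fin 2) (w.1.adicCompletion L)) = M := rfl
  have hGU : G ∈ unitaryGroupOfForm (galAdicCompletionMap (L := L) (IsCMField.complexConj L) hw)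
      !![(1 : w.1.adicCompletion L), 0; 0, -(algebraMap L (w.1.adicCompletion L) ξ)] :=
    ((mem_unitaryGroupOfForm_and_det_eq_one_iff (galAdicCompletionMap (L := L) (IsCMField.complexConj L) hw) (algebraMap L (w.1.adicCompletion L) ξ) hσ hσξ G).2
      ⟨α, galAdicCompletionMap (L := L) (IsCMField.complexConj L) hw β, hGM, h'⟩).1
  have hGU' : G ∈ unitaryGroupOfForm (galAdicCompletionMap (L := L) (IsCMField.complexConj L) hw) (placeForm !![(1 : L), 0; 0, -ξ] w.1) := by
    rw [placeForm_anisoPlane L v w ξ]; exact hGU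
  -- pull back to the CM carrier and read integrality at `w`
  intro htop
  set x := (localNonsplitEquiv (IsCMField.complexConj L) !![(1 : L), 0; 0, -ξ] hc1 w hw).symm ⟨G, hGU'⟩ with hx
  have hxK : x ∈ cmLocalIntegralLevel L 2 !![(1 : L), 0; 0, -ξ] v := by rw [htop]; exact Subgroup.mem_top x
  have hint := (mem_localIntegralLevel_iff_of_smul_eq (IsCMField.complexConj L) 2 !![(1 : L), 0; 0, -ξ] hc1 w hw x).1 hxK
  rw [hx, ContinuousMulEquiv.apply_symm_apply] at hint
  have hle := ((mem_glInt_iff_forall_v_le_one_and_v_det_eq_one G).1 hint).1 1 0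
  rw [hGM, hM] at hle
  simp only [Matrix.of_apply, Matrix.cons_val', Matrix.cons_val_zero, Matrix.cons_val_one, Matrix.empty_val', Matrix.cons_val_fin_one, hσ] at hle
  exact absurd hle (not_le.2 hβ)

end Carrier

end Summit.HodgeConjecture.HodgeConjecture.Cruxes.H413.K2E3WildAnisotropicPlaneNonIntegral

end
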